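import Mathlib.Analysis.Calculus.IteratedDeriv.Lemmas
import Literature.Claims.NS.Nadirashvili2026
import HarnessLib

/-!
# Solo refutation companion (D-0090 NS-CLAIMS, C129): Nadirashvili, arXiv 2606.02811 v4 (2026) —
# Step 7 at its abstract grain, `Step_SN1_abs` = (5.13) p.35

Cell `ns-claims`, row C129. File of record #2 of the refuter of record (ns-claims-refuter-5 g2),
ADOPTED from the kit of **ns-claims-typist-10 g3** (idle-typist kit pool, RULINGS v1.29r (2)(b);
kit sha16 6a09475284f52bd2, proofs unchanged, hygiene-only edits); sibling of
`Theorems/SoloRefuteNadirashvili2026.lean` (the (5.18) p.36 `Step_subsol` kill). Imports the LANDED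
skeleton `Literature.Claims.NS.Nadirashvili2026` (p493920 @ 192b4a679bf1, rev 2 p494606 @
aae3f8e00646).

Target: `Literature.Claims.NS.Nadirashvili2026.Step_SN1_abs` — (5.13) p.35 [TeX l.1539–1544]
«Assume that ∂⁵E(0,t₀)/∂r⁵ ≥ k, then from Lemma 5.5 and inequality (5.9) follows, that for
sufficiently large k E_r(1/k^{3/2}, t₀) > y′_k(1/k^{3/2})», typed (HYGIENE 13) at the level its
printed justification consumes it: for every absolutely monotonic smooth `F` (all derivatives `≥ 0`
on `[0,1)`) with `F(0) = F′(0) = F″(0) = F‴(0) = 0`, `F⁽⁴⁾(0) ≥ k`, `F⁽⁶⁾(0) ≥ c₆ F⁽⁴⁾(0)²/B`,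
`F⁽⁸⁾(0) ≥ c₈ F⁽⁴⁾(0)³/B²`, the claim is `y′_k(k^{−3/2}) < F(k^{−3/2})` for `k ≥ k₀(c₆, c₈, B)`.

Countermodel (polynomial, every `c₆, c₈, B > 0`, every threshold `k₀`): with `k = m¹⁶`, `m ∈ ℕ`,
`m ≥ max(k₀, 1, M)`, `M = c₆/(720B) + c₈/(40320B²)`, the polynomial
`F(x) = (k/24)x⁴ + (c₆k²/(720B))x⁶ + (c₈k³/(40320B²))x⁸` has non-negative coefficients (so every
derivative is `≥ 0` on `[0,∞)`), the printed jet at `0` (`F⁽⁴⁾(0) = k`, `F⁽⁶⁾(0) = c₆k²/B`,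
`F⁽⁸⁾(0) = c₈k³/B²`), and at `δ = k^{−3/2} = m^{−24}` (all real powers collapse to integer
powers: `δ^{33/8} = m^{−99}`):
`F(δ) − y′_k(δ) = c₆ m^{−112}/(720B) + c₈ m^{−144}/(40320B²) − (41/8)m^{−99} ≤ 0`.
So (5.13) at this grain FAILS for every choice of the constants: the excess of `E_r` over its
leading Taylor term that Lemma 5.5 + (5.9) provide is `O(k^{−7})` at `δ = k^{−3/2}`, below the
`(41/8)δ^{33/8} = (41/8)k^{−99/16}` needed (cf. claims/Nadirashvili2026/REFUTER.md §2 F2,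
RETYPE.md §1, CARD §7 — same exponent count).

Decls: `witF` (the witness), `iteratedDeriv_witF` (closed form of every derivative),
`not_step_SN1_abs_at` (parametrised: EVERY `c₆, c₈, B > 0`), `not_Step_SN1_abs`. Std axioms only.

WHAT THIS IS NOT: not a claim about NS regularity or blow-up; not a claim about any author beyond
the typed locator.
-/

noncomputable section

-- lint debt (cell convention, SoloRefute files): the Theorems namespace repeats
-- `NavierStokesRegularity`.
set_option linter.dupNamespace false

namespace Summit.NavierStokesRegularity.NavierStokesRegularity.Theorems.Nadirashvili2026

open scoped ContDiff
open Literature.Claims.NS.Nadirashvili2026 Set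

/-- The polynomial witness `F(x) = A x⁴ + P x⁶ + Q x⁸` for (5.13) at the abstract grain.
[folklore] -/
def witF (A P Q : ℝ) (x : ℝ) : ℝ :=
  A * x ^ 4 + P * x ^ 6 + Q * x ^ 8

/-- `witF` is smooth (a polynomial). [folklore] -/
theorem contDiff_witF (A P Q : ℝ) : ContDiff ℝ ∞ (witF A P Q) := by
  unfold witF
  fun_prop

/-- Closed form of every iterated derivative of the witness:
`F⁽ⁿ⁾(x) = A·4ₙ x^{4−n} + P·6ₙ x^{6−n} + Q·8ₙ x^{8−n}` (falling factorials, truncated subtraction).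
[folklore] -/
theorem iteratedDeriv_witF (A P Q : ℝ) (n : ℕ) (x : ℝ) :
    iteratedDeriv n (witF A P Q) x =
      A * ((Nat.descFactorial 4 n : ℝ) * x ^ (4 - n)) +
        P * ((Nat.descFactorial 6 n : ℝ) * x ^ (6 - n)) +
          Q * ((Nat.descFactorial 8 n : ℝ) * x ^ (8 - n)) := by
  unfold witF
  rw [iteratedDeriv_fun_add (by fun_prop) (by fun_prop),
    iteratedDeriv_fun_add (by fun_prop) (by fun_prop),
    iteratedDeriv_const_mul_field, iteratedDeriv_const_mul_field, iteratedDeriv_const_mul_field,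
    iteratedDeriv_pow, iteratedDeriv_pow, iteratedDeriv_pow]

/-- Every derivative of the witness is non-negative on `[0,∞)` when `A, P, Q ≥ 0`. [folklore] -/
theorem iteratedDeriv_witF_nonneg {A P Q : ℝ} (hA : 0 ≤ A) (hP : 0 ≤ P) (hQ : 0 ≤ Q) (n : ℕ)
    {x : ℝ} (hx : 0 ≤ x) : 0 ≤ iteratedDeriv n (witF A P Q) x := by
  rw [iteratedDeriv_witF]
  positivity

/-- The jet of the witness at `0`: orders `0,1,2,3` vanish. [folklore] -/
theorem iteratedDeriv_witF_zero_of_lt (A P Q : ℝ) {n : ℕ} (hn : n < 4) :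
    iteratedDeriv n (witF A P Q) 0 = 0 := by
  rw [iteratedDeriv_witF]
  have h1 : (0 : ℝ) ^ (4 - n) = 0 := zero_pow (by omega)
  have h2 : (0 : ℝ) ^ (6 - n) = 0 := zero_pow (by omega)
  have h3 : (0 : ℝ) ^ (8 - n) = 0 := zero_pow (by omega)
  rw [h1, h2, h3]
  ring

/-- `F⁽⁴⁾(0) = 24A`. [folklore] -/
theorem iteratedDeriv_witF_four (A P Q : ℝ) : iteratedDeriv 4 (witF A P Q) 0 = 24 * A := by
  have d : Nat.descFactorial 4 4 = 24 := by decide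
  rw [iteratedDeriv_witF, d]
  norm_num
  ring

/-- `F⁽⁶⁾(0) = 720P`. [folklore] -/
theorem iteratedDeriv_witF_six (A P Q : ℝ) : iteratedDeriv 6 (witF A P Q) 0 = 720 * P := by
  have d4 : Nat.descFactorial 4 6 = 0 := by decide
  have d6 : Nat.descFactorial 6 6 = 720 := by decide
  rw [iteratedDeriv_witF, d4, d6]
  norm_num
  ring

/-- `F⁽⁸⁾(0) = 40320Q`. [folklore] -/
theorem iteratedDeriv_witF_eight (A P Q : ℝ) : iteratedDeriv 8 (witF A P Q) 0 = 40320 * Q := by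
  have d4 : Nat.descFactorial 4 8 = 0 := by decide
  have d6 : Nat.descFactorial 6 8 = 0 := by decide
  have d8 : Nat.descFactorial 8 8 = 40320 := by decide
  rw [iteratedDeriv_witF, d4, d6, d8]
  norm_num
  ring

/-- Real-power collapse: `(t^a)^{p/a} = t^p` for `t > 0`. [folklore] -/
theorem sn1_rpow_pow_div {t : ℝ} (ht : 0 < t) (a p : ℕ) (ha : a ≠ 0) :
    (t ^ a) ^ ((p : ℝ) / a) = t ^ p := by
  rw [← Real.rpow_natCast t a, ← Real.rpow_mul ht.le]
  have : ((a : ℕ) : ℝ) * ((p : ℝ) / a) = (p : ℝ) := by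
    field_simp
  rw [this, Real.rpow_natCast]

/-- `δ = k^{−3/2} = m^{−24}` at `k = m¹⁶`. [folklore] -/
theorem sn1_delta_eq {m : ℝ} (hm : 0 < m) :
    (m ^ 16) ^ (-(3 / 2 : ℝ)) = (m⁻¹) ^ 24 := by
  have h := sn1_rpow_pow_div hm 16 24 (by norm_num)
  have e : ((24 : ℕ) : ℝ) / ((16 : ℕ) : ℝ) = 3 / 2 := by norm_num
  rw [e] at h
  rw [Real.rpow_neg (by positivity), h, inv_pow]

/-- `(t²⁴)^{33/8} = t⁹⁹` for `t > 0`. [folklore] -/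
theorem sn1_pow24_rpow {t : ℝ} (ht : 0 < t) :
    (t ^ 24) ^ (33 / 8 : ℝ) = t ^ 99 := by
  have h := sn1_rpow_pow_div ht 24 99 (by norm_num)
  have e : ((99 : ℕ) : ℝ) / ((24 : ℕ) : ℝ) = 33 / 8 := by norm_num
  rw [e] at h
  exact h

/-- **Kill of Step 7 at the abstract grain, parametrised: for EVERY `c₆, c₈, B > 0` there is NO
threshold `k₀` making (5.13) p.35 true for all admissible `F`** (witness `witF` at `k = m¹⁶`).
Class: false lemma (countermodel, functions grain). [cite: Nadirashvili2026, (5.13) p.35]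
WHAT THIS IS NOT: not a claim about NS regularity or blow-up; not a claim about any author beyond
the typed locator. -/
theorem not_step_SN1_abs_at {c₆ c₈ B : ℝ} (hc₆ : 0 < c₆) (hc₈ : 0 < c₈) (hB : 0 < B) :
    ¬ ∃ k₀ : ℝ, ∀ k : ℝ, k₀ ≤ k →
      ∀ F : ℝ → ℝ, ContDiff ℝ ∞ F → (∀ n : ℕ, ∀ x ∈ Ico (0 : ℝ) 1, 0 ≤ iteratedDeriv n F x) →
        F 0 = 0 → deriv F 0 = 0 → iteratedDeriv 2 F 0 = 0 → iteratedDeriv 3 F 0 = 0 →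
          k ≤ iteratedDeriv 4 F 0 →
            c₆ * (iteratedDeriv 4 F 0) ^ 2 / B ≤ iteratedDeriv 6 F 0 →
              c₈ * (iteratedDeriv 4 F 0) ^ 3 / B ^ 2 ≤ iteratedDeriv 8 F 0 →
                dyk k (k ^ (-(3 / 2 : ℝ))) < F (k ^ (-(3 / 2 : ℝ))) := by
  rintro ⟨k₀, hk⟩
  -- the threshold: m ≥ max (k₀, 1, M)
  set M : ℝ := c₆ / (720 * B) + c₈ / (40320 * B ^ 2) with hM
  have hM0 : 0 ≤ M := by positivity
  obtain ⟨m, hm⟩ := exists_nat_ge (max k₀ (max M 1))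
  have hm1 : (1 : ℝ) ≤ m := le_trans (le_trans (le_max_right _ _) (le_max_right _ _)) hm
  have hmM : M ≤ m := le_trans (le_trans (le_max_left _ _) (le_max_right _ _)) hm
  have hmk₀ : k₀ ≤ m := le_trans (le_max_left _ _) hm
  have hm0 : (0 : ℝ) < m := by linarith
  -- k = m¹⁶ and the witness
  set k : ℝ := (m : ℝ) ^ 16 with hk_def
  have hk1 : 1 ≤ k := one_le_pow₀ hm1
  have hk0 : 0 ≤ k := by linarith
  have hkk₀ : k₀ ≤ k := le_trans hmk₀ (le_self_pow₀ hm1 (by norm_num))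
  set A : ℝ := k / 24 with hA
  set P : ℝ := c₆ * k ^ 2 / (720 * B) with hP
  set Q : ℝ := c₈ * k ^ 3 / (40320 * B ^ 2) with hQ
  have hA0 : 0 ≤ A := by positivity
  have hP0 : 0 ≤ P := by positivity
  have hQ0 : 0 ≤ Q := by positivity
  have hB0 : B ≠ 0 := hB.ne'
  have h4 : iteratedDeriv 4 (witF A P Q) 0 = k := by rw [iteratedDeriv_witF_four, hA]; ring
  have h6 : c₆ * (iteratedDeriv 4 (witF A P Q) 0) ^ 2 / B ≤ iteratedDeriv 6 (witF A P Q) 0 := by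
    rw [h4, iteratedDeriv_witF_six, hP]
    exact le_of_eq (by field_simp)
  have h8 :
      c₈ * (iteratedDeriv 4 (witF A P Q) 0) ^ 3 / B ^ 2 ≤ iteratedDeriv 8 (witF A P Q) 0 := by
    rw [h4, iteratedDeriv_witF_eight, hQ]
    exact le_of_eq (by field_simp)
  have hlt := hk k hkk₀ (witF A P Q) (contDiff_witF A P Q)
    (fun n x hx => iteratedDeriv_witF_nonneg hA0 hP0 hQ0 n hx.1)
    (by simp [witF])
    (by rw [← iteratedDeriv_one]; exact iteratedDeriv_witF_zero_of_lt A P Q (by norm_num))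
    (iteratedDeriv_witF_zero_of_lt A P Q (by norm_num))
    (iteratedDeriv_witF_zero_of_lt A P Q (by norm_num))
    h4.symm.le h6 h8
  -- evaluate both sides at δ = m^{-24} = t^24, t = m⁻¹ ∈ (0,1]
  rw [hk_def, sn1_delta_eq hm0] at hlt
  set t : ℝ := (m : ℝ)⁻¹ with ht
  have ht0 : 0 < t := inv_pos.mpr hm0
  have ht1 : t ≤ 1 := inv_le_one_of_one_le₀ hm1
  have htM : M * t ≤ 1 := by
    rw [ht, ← div_eq_mul_inv, div_le_one hm0]
    exact hmM
  have hkt : (m : ℝ) ^ 16 * t ^ 16 = 1 := by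
    rw [ht, inv_pow, mul_inv_cancel₀ (pow_pos hm0 16).ne']
  -- closed forms at δ
  have hdyk : dyk ((m : ℝ) ^ 16) (t ^ 24) = t ^ 80 / 24 + 41 / 8 * t ^ 99 := by
    unfold dyk
    rw [sn1_pow24_rpow ht0]
    linear_combination (t ^ 80 / 24) * hkt
  have hF : witF A P Q (t ^ 24) =
      t ^ 80 / 24 + c₆ / (720 * B) * t ^ 112 + c₈ / (40320 * B ^ 2) * t ^ 144 := by
    unfold witF
    rw [hA, hP, hQ, hk_def]
    linear_combination
      (t ^ 80 / 24 + c₆ / (720 * B) * ((m : ℝ) ^ 16 * t ^ 16 + 1) * t ^ 112 +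
        c₈ / (40320 * B ^ 2) * (((m : ℝ) ^ 16 * t ^ 16) ^ 2 + (m : ℝ) ^ 16 * t ^ 16 + 1) *
          t ^ 144) * hkt
  rw [hdyk, hF] at hlt
  -- the excess is too small: c₆/(720B) t¹¹² + c₈/(40320B²) t¹⁴⁴ ≤ M t¹⁰⁰ ≤ t⁹⁹ ≤ (41/8) t⁹⁹
  have h99 : 0 < t ^ 99 := pow_pos ht0 99
  have h112 : t ^ 112 ≤ t ^ 100 := pow_le_pow_of_le_one ht0.le ht1 (by norm_num)
  have h144 : t ^ 144 ≤ t ^ 100 := pow_le_pow_of_le_one ht0.le ht1 (by norm_num)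
  have hc1 : 0 ≤ c₆ / (720 * B) := by positivity
  have hc2 : 0 ≤ c₈ / (40320 * B ^ 2) := by positivity
  have hsum :
      c₆ / (720 * B) * t ^ 112 + c₈ / (40320 * B ^ 2) * t ^ 144 ≤ M * t * t ^ 99 := by
    have : M * t * t ^ 99 = M * t ^ 100 := by ring
    rw [this, hM, add_mul]
    exact add_le_add (mul_le_mul_of_nonneg_left h112 hc1) (mul_le_mul_of_nonneg_left h144 hc2)
  have hfin : M * t * t ^ 99 ≤ 41 / 8 * t ^ 99 := by
    apply mul_le_mul_of_nonneg_right _ h99.le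
    linarith
  linarith

/-- **Kill of Step 7 at its abstract grain** — `¬ Step_SN1_abs` ((5.13) p.35 [TeX l.1539–1544],
HYGIENE-13 level): instance `c₆ = c₈ = B = 1` of `not_step_SN1_abs_at`.
Class: false lemma (countermodel, functions grain). [cite: Nadirashvili2026, (5.13) p.35]
WHAT THIS IS NOT: not a claim about NS regularity or blow-up; not a claim about any author beyond
the typed locator. -/
theorem not_Step_SN1_abs : ¬ Literature.Claims.NS.Nadirashvili2026.Step_SN1_abs := fun h =>
  not_step_SN1_abs_at one_pos one_pos one_pos (h 1 1 1 one_pos one_pos one_pos)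

end Summit.NavierStokesRegularity.NavierStokesRegularity.Theorems.Nadirashvili2026

end
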